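import Literature.NumberTheory.Sieve.BombieriFriedlanderIwaniecDispersion
import HarnessLib

/-!
# Bombieri–Friedlander–Iwaniec 1986, §17: the ranges of Theorems 0 (b), 1, 2 and 5* for Theorem 10

Trunk `AntSieve`, companion to `Literature.NumberTheory.Sieve.BombieriFriedlanderIwaniecCombinatorics`.
Everything here is PROVED; it is exponent arithmetic only (no number theory).  BFI §17 (p. 249)
dispatches a sieved, boxed Heath-Brown piece with `x = M N`, `N = x^s`, according to the exponents:
"Theorem 1 is applicable if `x^{2/7−ε} < N < x^{3/7+ε}` … Theorem 2 … if `x^{1/7−ε} < N < x^{2/7+ε}`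
… Theorem 5* is applicable with `M = N₁ = x^{ν₁} ≥ x^{3/7}` and `Q, R ≤ x^{2/7−2ε}`", with the
well-factorable weight split as `λ = λ₁ ⋆ λ₂`, `R = x^{−ε}N`, `Q ≤ x^{4/7−4ε} N^{−1}`.

We fix the bookkeeping used by the assembly of Theorem 10 in this library (level `D ≤ X^{4/7−ε}`,
`0 < ε ≤ 1/1000`, range parameter `ε₁ = ε/100` for the cited theorems, all moduli blocks
`Q'' ≤ D₁/2`, `R'' ≤ D₂/2` of the dyadic decomposition `D = D₁ D₂`):

* `thm1_ranges` — for `s ∈ [2/7 − 3ε/2, 3/7 − ε + ε₁]` and `D₂ = X^{s−ε₁}`: every block satisfies the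
  seven numerical hypotheses of `Literature.NumberTheory.Sieve.BombieriFriedlanderIwaniecTheorem1` (with `ε₁`).
* `thm2_ranges` — for `s ∈ [3/14 − ε/2 + ε₁/2, 2/7 − 3ε/2]`, `D₂ = X^{s−ε₁}` and blocks with
  `R'' > X^{ρ_c}/2`, `ρ_c = 1/7 − 2ε + 5ε₁`: the hypotheses of `Literature.NumberTheory.Sieve.BombieriFriedlanderIwaniecTheorem2`.
  (Blocks with smaller `R''` are NOT covered by Theorem 2 — its first condition is increasing in `R` —
  and are recombined for Theorem 0 (b): `thm0b_level`, level `D₁ X^{ρ_c} ≤ X^{1/2 − 2ε}`.)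
* `thm5_ranges` — for a single variable of exponent `τ > 3/7 − ε + ε₁`, `τ ≤ 1 − ε₁`, and
  `D₂ = X^{1/7}`: condition (12.5) of Theorem 5* (`Literature.NumberTheory.Sieve.BFI.thm5Threshold`) for every block.

## References

* E. Bombieri, J. B. Friedlander, H. Iwaniec, Acta Math. 156 (1986), §17 p. 249 ((17.1), (17.2)).
  [BombieriFriedlanderIwaniecActa1986]
-/

open Real

namespace Literature.NumberTheory.Sieve

namespace BFI

/-! ### Small `rpow` helpers -/

/-- `X^u · X^v = X^{u+v}` for `X > 0` (reversed `Real.rpow_add`). [folklore] -/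
theorem rpow_mul_rpow {X : ℝ} (hX : 0 < X) (u v : ℝ) : X ^ u * X ^ v = X ^ (u + v) :=
  (Real.rpow_add hX u v).symm

/-- `(X^u)^v = X^{uv}` for `X ≥ 0` (reversed `Real.rpow_mul`). [folklore] -/
theorem rpow_rpow {X : ℝ} (hX : 0 ≤ X) (u v : ℝ) : (X ^ u) ^ v = X ^ (u * v) :=
  (Real.rpow_mul hX u v).symm

/-- `Q ≤ X^θ`, `Q > 0`, `v ≤ 0` ⟹ `X^{θ v} ≤ Q^v`. [folklore] -/
theorem rpow_theta_mul_le_rpow {X Q θ v : ℝ} (hX : 0 ≤ X) (hQ : 0 < Q) (hQθ : Q ≤ X ^ θ) (hv : v ≤ 0) :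
    X ^ (θ * v) ≤ Q ^ v := by
  rw [Real.rpow_mul hX]
  exact Real.rpow_le_rpow_of_nonpos hQ hQθ hv

/-- `R ≤ X^ρ / 2`, `R > 0` ⟹ `X^{−ρ} ≤ R⁻¹`. [folklore] -/
theorem rpow_neg_le_inv {X R ρ : ℝ} (hX : 0 < X) (hR : 0 < R) (hRρ : R ≤ X ^ ρ / 2) : X ^ (-ρ) ≤ R⁻¹ := by
  rw [Real.rpow_neg hX.le]
  have hρ : 0 < X ^ ρ := Real.rpow_pos_of_pos hX ρ
  exact inv_anti₀ hR (by linarith)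

/-! ### Theorem 1 -/

/-- **The range of Theorem 1 in the proof of Theorem 10** ((17.1), with the bookkeeping of the module
docstring): for `0 < ε ≤ 1/1000`, `ε₁ = ε/100`, `s ∈ [2/7 − 3ε/2, 3/7 − ε + ε₁]`, `X ≥ 2`, `N = X^s`,
and a block `1/2 ≤ Q ≤ X^{4/7−ε−(s−ε₁)}/2`, `1/2 ≤ R ≤ X^{s−ε₁}/2`, all numerical hypotheses of
`Literature.NumberTheory.Sieve.BombieriFriedlanderIwaniecTheorem1` (range parameter `ε₁`) hold. [cite: BombieriFriedlanderIwaniecActa1986, §17 (17.1) p. 249] -/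
theorem thm1_ranges {ε s X N Q R : ℝ} (hε : 0 < ε) (hε' : ε ≤ 1 / 1000)
    (hs1 : 2 / 7 - 3 / 2 * ε ≤ s) (hs2 : s ≤ 3 / 7 - ε + ε / 100)
    (hX : 2 ≤ X) (hN : N = X ^ s)
    (hQ0 : 1 / 2 ≤ Q) (hR0 : 1 / 2 ≤ R)
    (hQ : Q ≤ X ^ (4 / 7 - ε - (s - ε / 100)) / 2) (hR : R ≤ X ^ (s - ε / 100) / 2) :
    X ^ (ε / 100) ≤ N ∧ N ≤ X ^ (1 - ε / 100) ∧ Q * R < X ∧ X ^ (ε / 100) * R < N ∧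
    N < X ^ (-(ε / 100)) * (X ^ (1 / 2 : ℝ) * Q ^ (-(1 / 2) : ℝ)) ∧
    N < X ^ (-(ε / 100)) * (X ^ 2 * Q ^ (-5 : ℝ) * R⁻¹) ∧
    N < X ^ (-(ε / 100)) * (X * Q ^ (-2 : ℝ) * R ^ (-(1 / 2) : ℝ)) := by
  have hX0 : 0 < X := by linarith
  have hX1 : 1 < X := by linarith
  have hQpos : 0 < Q := by linarith
  have hRpos : 0 < R := by linarith
  set ε₁ : ℝ := ε / 100 with hε₁
  set θ : ℝ := 4 / 7 - ε - (s - ε₁) with hθ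
  set ρ : ℝ := s - ε₁ with hρ
  have hQθ : Q ≤ X ^ θ := by
    have : 0 < X ^ θ := Real.rpow_pos_of_pos hX0 θ
    linarith
  have hRρ : R ≤ X ^ ρ := by
    have : 0 < X ^ ρ := Real.rpow_pos_of_pos hX0 ρ
    linarith
  have lt_of_exp : ∀ {u v : ℝ}, u < v → X ^ u < X ^ v := fun h => Real.rpow_lt_rpow_of_exponent_lt hX1 h
  have le_of_exp : ∀ {u v : ℝ}, u ≤ v → X ^ u ≤ X ^ v := fun h => Real.rpow_le_rpow_of_exponent_le hX1.le h
  refine ⟨?_, ?_, ?_, ?_, ?_, ?_, ?_⟩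
  · rw [hN]; exact le_of_exp (by linarith)
  · rw [hN]; exact le_of_exp (by linarith)
  · -- `Q R ≤ X^{θ+ρ}/4 < X`
    have hlt : X ^ (θ + ρ) < X := by
      have h := lt_of_exp (show θ + ρ < 1 by simp only [hθ, hρ]; linarith)
      rwa [Real.rpow_one] at h
    have h4 : X ^ (θ + ρ) / 4 ≤ X ^ (θ + ρ) :=
      div_le_self (Real.rpow_nonneg hX0.le _) (by norm_num)
    calc Q * R ≤ X ^ θ / 2 * (X ^ ρ / 2) := mul_le_mul hQ hR hRpos.le (by positivity)
      _ = X ^ (θ + ρ) / 4 := by rw [Real.rpow_add hX0]; ring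
      _ < X := lt_of_le_of_lt h4 hlt
  · -- `X^{ε₁} R ≤ X^{ε₁+ρ}/2 = X^s/2 < X^s`
    have hNpos : 0 < X ^ s := Real.rpow_pos_of_pos hX0 s
    calc X ^ ε₁ * R ≤ X ^ ε₁ * (X ^ ρ / 2) := mul_le_mul_of_nonneg_left hR (Real.rpow_nonneg hX0.le _)
      _ = X ^ s / 2 := by rw [mul_div_assoc', rpow_mul_rpow hX0]; congr 2; simp [hρ]
      _ < N := by rw [hN]; linarith
  · -- `X^{−ε₁} X^{1/2} Q^{−1/2} ≥ X^{−ε₁ + 1/2 − θ/2} > X^s`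
    have h1 : X ^ (θ * (-(1 / 2) : ℝ)) ≤ Q ^ (-(1 / 2) : ℝ) :=
      rpow_theta_mul_le_rpow hX0.le hQpos hQθ (by norm_num)
    calc N = X ^ s := hN
      _ < X ^ (-ε₁ + (1 / 2 + θ * (-(1 / 2) : ℝ))) := lt_of_exp (by
          simp only [hθ, hε₁]; nlinarith)
      _ = X ^ (-ε₁) * (X ^ (1 / 2 : ℝ) * X ^ (θ * (-(1 / 2) : ℝ))) := by
          rw [Real.rpow_add hX0, Real.rpow_add hX0]
      _ ≤ X ^ (-ε₁) * (X ^ (1 / 2 : ℝ) * Q ^ (-(1 / 2) : ℝ)) :=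
          mul_le_mul_of_nonneg_left (mul_le_mul_of_nonneg_left h1 (Real.rpow_nonneg hX0.le _))
            (Real.rpow_nonneg hX0.le _)
  · -- `X^{−ε₁} X² Q^{−5} R⁻¹ ≥ X^{−ε₁ + 2 − 5θ − ρ} > X^s`
    have h1 : X ^ (θ * (-5 : ℝ)) ≤ Q ^ (-5 : ℝ) := rpow_theta_mul_le_rpow hX0.le hQpos hQθ (by norm_num)
    have h2 : X ^ (-ρ) ≤ R⁻¹ := rpow_neg_le_inv hX0 hRpos hR
    calc N = X ^ s := hN
      _ < X ^ (-ε₁ + ((2 : ℝ) + θ * (-5 : ℝ) + -ρ)) := lt_of_exp (by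
          simp only [hθ, hε₁, hρ]; nlinarith)
      _ = X ^ (-ε₁) * (X ^ (2 : ℝ) * X ^ (θ * (-5 : ℝ)) * X ^ (-ρ)) := by
          rw [Real.rpow_add hX0, Real.rpow_add hX0, Real.rpow_add hX0]
      _ = X ^ (-ε₁) * (X ^ 2 * X ^ (θ * (-5 : ℝ)) * X ^ (-ρ)) := by rw [Real.rpow_two]
      _ ≤ X ^ (-ε₁) * (X ^ 2 * Q ^ (-5 : ℝ) * R⁻¹) := by
          refine mul_le_mul_of_nonneg_left ?_ (Real.rpow_nonneg hX0.le _)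
          exact mul_le_mul (mul_le_mul_of_nonneg_left h1 (by positivity)) h2
            (Real.rpow_nonneg hX0.le _) (by positivity)
  · -- `X^{−ε₁} X Q^{−2} R^{−1/2} ≥ X^{−ε₁ + 1 − 2θ − ρ/2} > X^s`
    have h1 : X ^ (θ * (-2 : ℝ)) ≤ Q ^ (-2 : ℝ) := rpow_theta_mul_le_rpow hX0.le hQpos hQθ (by norm_num)
    have h2 : X ^ (ρ * (-(1 / 2) : ℝ)) ≤ R ^ (-(1 / 2) : ℝ) :=
      rpow_theta_mul_le_rpow hX0.le hRpos hRρ (by norm_num)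
    calc N = X ^ s := hN
      _ < X ^ (-ε₁ + ((1 : ℝ) + θ * (-2 : ℝ) + ρ * (-(1 / 2) : ℝ))) := lt_of_exp (by
          simp only [hθ, hε₁, hρ]; nlinarith)
      _ = X ^ (-ε₁) * (X ^ (1 : ℝ) * X ^ (θ * (-2 : ℝ)) * X ^ (ρ * (-(1 / 2) : ℝ))) := by
          rw [Real.rpow_add hX0, Real.rpow_add hX0, Real.rpow_add hX0]
      _ = X ^ (-ε₁) * (X * X ^ (θ * (-2 : ℝ)) * X ^ (ρ * (-(1 / 2) : ℝ))) := by rw [Real.rpow_one]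
      _ ≤ X ^ (-ε₁) * (X * Q ^ (-2 : ℝ) * R ^ (-(1 / 2) : ℝ)) := by
          refine mul_le_mul_of_nonneg_left ?_ (Real.rpow_nonneg hX0.le _)
          exact mul_le_mul (mul_le_mul_of_nonneg_left h1 hX0.le) h2
            (Real.rpow_nonneg hX0.le _) (by positivity)

/-! ### Theorem 2 and the level of Theorem 0 (b) -/

/-- `(X^θ)^n = X^{θ n}` for natural `n` and `X ≥ 0`. [folklore] -/
theorem rpow_pow_natCast {X : ℝ} (hX : 0 ≤ X) (θ : ℝ) (n : ℕ) : (X ^ θ) ^ n = X ^ (θ * n) := by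
  rw [← Real.rpow_natCast, ← Real.rpow_mul hX]

/-- **The range of Theorem 2 in the proof of Theorem 10** ((17.2), with the bookkeeping of the module
docstring): for `0 < ε ≤ 1/1000`, `ε₁ = ε/100`, `s ∈ [3/14 − ε/2 + ε₁/2, 2/7 − 3ε/2]`, `X ≥ 2`, `N = X^s`,
and a block `1/2 ≤ Q ≤ X^{4/7−ε−(s−ε₁)}/2`, `X^{ρ_c}/2 ≤ R ≤ X^{s−ε₁}/2` with `ρ_c = 1/7 − 2ε + 5ε₁`, all
numerical hypotheses of `Literature.NumberTheory.Sieve.BombieriFriedlanderIwaniecTheorem2` (range parameter `ε₁`) hold.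
[cite: BombieriFriedlanderIwaniecActa1986, §17 (17.2) p. 249] -/
theorem thm2_ranges {ε s X N Q R : ℝ} (hε : 0 < ε) (hε' : ε ≤ 1 / 1000)
    (hs1 : 3 / 14 - ε / 2 + ε / 200 ≤ s) (hs2 : s ≤ 2 / 7 - 3 / 2 * ε)
    (hX : 2 ≤ X) (hN : N = X ^ s)
    (hQ0 : 1 / 2 ≤ Q) (hQ : Q ≤ X ^ (4 / 7 - ε - (s - ε / 100)) / 2)
    (hRc : X ^ (1 / 7 - 2 * ε + 5 * (ε / 100)) / 2 ≤ R) (hR : R ≤ X ^ (s - ε / 100) / 2) :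
    X ^ (ε / 100) ≤ N ∧ N ≤ X ^ (1 - ε / 100) ∧ Q * R < X ∧ X ^ (ε / 100) * R < N ∧
    N < X ^ (-(ε / 100)) * (X * R / Q ^ 2) ^ (1 / 2 : ℝ) ∧
    N < X ^ (-(ε / 100)) * (X / Q) ^ (2 / 5 : ℝ) ∧
    N < X ^ (-(ε / 100)) * (X ^ 2 / Q ^ 3) ^ (1 / 4 : ℝ) := by
  have hX0 : 0 < X := by linarith
  have hX1 : 1 < X := by linarith
  have hQpos : 0 < Q := by linarith
  set ε₁ : ℝ := ε / 100 with hε₁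
  set ρ : ℝ := s - ε₁ with hρ
  set θ : ℝ := 4 / 7 - ε - ρ with hθ
  set ρc : ℝ := 1 / 7 - 2 * ε + 5 * ε₁ with hρc
  have hRcpos : 0 < X ^ ρc / 2 := by positivity
  have hRpos : 0 < R := lt_of_lt_of_le hRcpos hRc
  have hQθ : Q ≤ X ^ θ := by
    have : 0 < X ^ θ := Real.rpow_pos_of_pos hX0 θ
    linarith
  have lt_of_exp : ∀ {u v : ℝ}, u < v → X ^ u < X ^ v := fun h => Real.rpow_lt_rpow_of_exponent_lt hX1 h
  have le_of_exp : ∀ {u v : ℝ}, u ≤ v → X ^ u ≤ X ^ v := fun h => Real.rpow_le_rpow_of_exponent_le hX1.le h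
  refine ⟨?_, ?_, ?_, ?_, ?_, ?_, ?_⟩
  · rw [hN]; exact le_of_exp (by linarith)
  · rw [hN]; exact le_of_exp (by linarith)
  · have hlt : X ^ (θ + ρ) < X := by
      have h := lt_of_exp (show θ + ρ < 1 by simp only [hθ]; linarith)
      rwa [Real.rpow_one] at h
    have h4 : X ^ (θ + ρ) / 4 ≤ X ^ (θ + ρ) :=
      div_le_self (Real.rpow_nonneg hX0.le _) (by norm_num)
    calc Q * R ≤ X ^ θ / 2 * (X ^ ρ / 2) := mul_le_mul hQ hR hRpos.le (by positivity)
      _ = X ^ (θ + ρ) / 4 := by rw [Real.rpow_add hX0]; ring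
      _ < X := lt_of_le_of_lt h4 hlt
  · have hNpos : 0 < X ^ s := Real.rpow_pos_of_pos hX0 s
    calc X ^ ε₁ * R ≤ X ^ ε₁ * (X ^ ρ / 2) := mul_le_mul_of_nonneg_left hR (Real.rpow_nonneg hX0.le _)
      _ = X ^ s / 2 := by rw [mul_div_assoc', rpow_mul_rpow hX0]; congr 2; simp [hρ]
      _ < N := by rw [hN]; linarith
  · -- `X R / Q² ≥ X · (X^{ρc}/2) · 4 X^{−2θ} ≥ X^{1 + ρc − 2θ}`
    have hQ2 : Q ^ 2 ≤ X ^ (θ * 2) / 4 := by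
      have h := pow_le_pow_left₀ hQpos.le hQ 2
      rw [div_pow, rpow_pow_natCast hX0.le] at h
      norm_num at h
      simpa using h
    have hQ2pos : 0 < Q ^ 2 := by positivity
    have hinv : 4 * (X ^ (θ * 2))⁻¹ ≤ (Q ^ 2)⁻¹ := by
      have h := inv_anti₀ hQ2pos hQ2
      rw [inv_div] at h
      rw [← div_eq_mul_inv]
      exact h
    have hlow : X ^ (1 + ρc + -(θ * 2)) ≤ X * R / Q ^ 2 := by
      have hx2θ : 0 < X ^ (θ * 2) := Real.rpow_pos_of_pos hX0 _
      calc X ^ (1 + ρc + -(θ * 2)) = X * X ^ ρc * (X ^ (θ * 2))⁻¹ := by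
            rw [Real.rpow_add hX0, Real.rpow_add hX0, Real.rpow_one, Real.rpow_neg hX0.le]
        _ ≤ X * (2 * R) * (X ^ (θ * 2))⁻¹ := by
            refine mul_le_mul_of_nonneg_right (mul_le_mul_of_nonneg_left (by linarith) hX0.le) ?_
            positivity
        _ ≤ X * (2 * R) * (2 * (X ^ (θ * 2))⁻¹) := by
            refine mul_le_mul_of_nonneg_left ?_ (by positivity)
            have : 0 ≤ (X ^ (θ * 2))⁻¹ := by positivity
            linarith
        _ = X * R * (4 * (X ^ (θ * 2))⁻¹) := by ring
        _ ≤ X * R * (Q ^ 2)⁻¹ := mul_le_mul_of_nonneg_left hinv (by positivity)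
        _ = X * R / Q ^ 2 := (div_eq_mul_inv _ _).symm
    have hhalf : (X ^ (1 + ρc + -(θ * 2))) ^ (1 / 2 : ℝ) ≤ (X * R / Q ^ 2) ^ (1 / 2 : ℝ) :=
      Real.rpow_le_rpow (Real.rpow_nonneg hX0.le _) hlow (by norm_num)
    rw [rpow_rpow hX0.le] at hhalf
    calc N = X ^ s := hN
      _ < X ^ (-ε₁ + (1 + ρc + -(θ * 2)) * (1 / 2 : ℝ)) := lt_of_exp (by
          simp only [hθ, hρc, hρ, hε₁]; nlinarith)
      _ = X ^ (-ε₁) * X ^ ((1 + ρc + -(θ * 2)) * (1 / 2 : ℝ)) := Real.rpow_add hX0 _ _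
      _ ≤ X ^ (-ε₁) * (X * R / Q ^ 2) ^ (1 / 2 : ℝ) := mul_le_mul_of_nonneg_left hhalf (Real.rpow_nonneg hX0.le _)
  · -- `X / Q ≥ X^{1−θ}`
    have hlow : X ^ (1 - θ) ≤ X / Q := by
      rw [Real.rpow_sub hX0, Real.rpow_one]
      exact div_le_div_of_nonneg_left hX0.le hQpos hQθ
    have h25 : (X ^ (1 - θ)) ^ (2 / 5 : ℝ) ≤ (X / Q) ^ (2 / 5 : ℝ) :=
      Real.rpow_le_rpow (Real.rpow_nonneg hX0.le _) hlow (by norm_num)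
    rw [rpow_rpow hX0.le] at h25
    calc N = X ^ s := hN
      _ < X ^ (-ε₁ + (1 - θ) * (2 / 5 : ℝ)) := lt_of_exp (by simp only [hθ, hρ, hε₁]; nlinarith)
      _ = X ^ (-ε₁) * X ^ ((1 - θ) * (2 / 5 : ℝ)) := Real.rpow_add hX0 _ _
      _ ≤ X ^ (-ε₁) * (X / Q) ^ (2 / 5 : ℝ) := mul_le_mul_of_nonneg_left h25 (Real.rpow_nonneg hX0.le _)
  · -- `X² / Q³ ≥ X^{2 − 3θ}`
    have hQ3 : Q ^ 3 ≤ X ^ (θ * 3) := by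
      have h := pow_le_pow_left₀ hQpos.le hQθ 3
      rwa [rpow_pow_natCast hX0.le] at h
    have hlow : X ^ (2 - θ * 3) ≤ X ^ 2 / Q ^ 3 := by
      rw [Real.rpow_sub hX0, Real.rpow_two]
      exact div_le_div_of_nonneg_left (by positivity) (by positivity) hQ3
    have h14 : (X ^ (2 - θ * 3)) ^ (1 / 4 : ℝ) ≤ (X ^ 2 / Q ^ 3) ^ (1 / 4 : ℝ) :=
      Real.rpow_le_rpow (Real.rpow_nonneg hX0.le _) hlow (by norm_num)
    rw [rpow_rpow hX0.le] at h14
    calc N = X ^ s := hN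
      _ < X ^ (-ε₁ + (2 - θ * 3) * (1 / 4 : ℝ)) := lt_of_exp (by simp only [hθ, hρ, hε₁]; nlinarith)
      _ = X ^ (-ε₁) * X ^ ((2 - θ * 3) * (1 / 4 : ℝ)) := Real.rpow_add hX0 _ _
      _ ≤ X ^ (-ε₁) * (X ^ 2 / Q ^ 3) ^ (1 / 4 : ℝ) := mul_le_mul_of_nonneg_left h14 (Real.rpow_nonneg hX0.le _)

/-- **The level kept aside for Theorem 0 (b)** in the Theorem-2 range: for
`s ≥ 3/14 − ε/2 + ε₁/2` the moduli `q r` with `q ≤ X^{4/7−ε−(s−ε₁)}` and `r ≤ X^{ρ_c}`,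
`ρ_c = 1/7 − 2ε + 5ε₁`, have level at most `X^{1/2 − 2ε}` (`X ≥ 1`).
[cite: BombieriFriedlanderIwaniecActa1986, §17 p. 249] -/
theorem thm0b_level {ε s X : ℝ} (hε : 0 < ε) (hs1 : 3 / 14 - ε / 2 + ε / 200 ≤ s) (hX : 1 ≤ X) :
    X ^ (4 / 7 - ε - (s - ε / 100)) * X ^ (1 / 7 - 2 * ε + 5 * (ε / 100)) ≤ X ^ (1 / 2 - 2 * ε) := by
  rw [← Real.rpow_add (by linarith)]
  exact Real.rpow_le_rpow_of_exponent_le hX (by linarith)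

/-! ### Theorem 5* -/

/-- **The range of Theorem 5* in the proof of Theorem 10** (BFI p. 249: "Theorem 5* is applicable with
`M = N₁ = x^{ν₁} ≥ x^{3/7}` and `Q, R ≤ x^{2/7−2ε}`"; with our bookkeeping `D₂ = X^{1/7}`,
`D₁ ≤ X^{3/7−ε}`): for `0 < ε ≤ 1/1000`, `ε₁ = ε/100`, `3/7 − ε + ε₁ < τ ≤ 1 − ε₁`, `X ≥ 2`, `M = X^τ`,
`M N = X`, and a block `1/2 ≤ Q ≤ X^{3/7−ε}`, `1/2 ≤ R ≤ X^{1/7}`: the numerical hypotheses (A₁), `QR < X`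
and (12.5) `X^{ε₁} max{Q, X⁻¹QR⁴, Q^{1/2}R, X⁻²Q³R⁴} < M` of `Literature.NumberTheory.Sieve.BombieriFriedlanderIwaniecTheorem5StarInterval`
hold. [cite: BombieriFriedlanderIwaniecActa1986, §17 p. 249] -/
theorem thm5_ranges {ε τ X M N Q R : ℝ} (hε : 0 < ε) (hε' : ε ≤ 1 / 1000)
    (hτ1 : 3 / 7 - ε + ε / 100 < τ) (hτ2 : τ ≤ 1 - ε / 100)
    (hX : 2 ≤ X) (hM : M = X ^ τ) (hMN : M * N = X)
    (hQ0 : 1 / 2 ≤ Q) (hR0 : 1 / 2 ≤ R) (hQ : Q ≤ X ^ (3 / 7 - ε)) (hR : R ≤ X ^ (1 / 7 : ℝ)) :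
    X ^ (ε / 100) ≤ N ∧ N ≤ X ^ (1 - ε / 100) ∧ Q * R < X ∧
    X ^ (ε / 100) * thm5Threshold X Q R < M := by
  have hX0 : 0 < X := by linarith
  have hX1 : 1 < X := by linarith
  have hQpos : 0 < Q := by linarith
  have hRpos : 0 < R := by linarith
  set ε₁ : ℝ := ε / 100 with hε₁
  set θ : ℝ := 3 / 7 - ε with hθ
  have lt_of_exp : ∀ {u v : ℝ}, u < v → X ^ u < X ^ v := fun h => Real.rpow_lt_rpow_of_exponent_lt hX1 h
  have le_of_exp : ∀ {u v : ℝ}, u ≤ v → X ^ u ≤ X ^ v := fun h => Real.rpow_le_rpow_of_exponent_le hX1.le h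
  have hMpos : 0 < M := by rw [hM]; exact Real.rpow_pos_of_pos hX0 τ
  have hN : N = X ^ (1 - τ) := by
    have h : N = X / M := by field_simp; linarith
    rw [h, hM, Real.rpow_sub hX0, Real.rpow_one]
  have hR4 : R ^ 4 ≤ X ^ ((1 / 7 : ℝ) * 4) := by
    have h := pow_le_pow_left₀ hRpos.le hR 4
    rwa [rpow_pow_natCast hX0.le] at h
  have hQ3 : Q ^ 3 ≤ X ^ (θ * 3) := by
    have h := pow_le_pow_left₀ hQpos.le hQ 3
    rwa [rpow_pow_natCast hX0.le] at h
  have hQhalf : Q ^ (1 / 2 : ℝ) ≤ X ^ (θ * (1 / 2 : ℝ)) := by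
    rw [Real.rpow_mul hX0.le]
    exact Real.rpow_le_rpow hQpos.le hQ (by norm_num)
  refine ⟨?_, ?_, ?_, ?_⟩
  · rw [hN]; exact le_of_exp (by linarith)
  · rw [hN]; exact le_of_exp (by linarith)
  · have hlt : X ^ (θ + 1 / 7) < X := by
      have h := lt_of_exp (show θ + 1 / 7 < 1 by simp only [hθ]; linarith)
      rwa [Real.rpow_one] at h
    calc Q * R ≤ X ^ θ * X ^ (1 / 7 : ℝ) := mul_le_mul hQ hR hRpos.le (Real.rpow_nonneg hX0.le _)
      _ = X ^ (θ + 1 / 7) := rpow_mul_rpow hX0 _ _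
      _ < X := hlt
  · -- each of the four terms is `< X^{τ − ε₁}`
    have hthr : thm5Threshold X Q R < X ^ (τ - ε₁) := by
      unfold thm5Threshold
      refine max_lt (max_lt ?_ ?_) (max_lt ?_ ?_)
      · exact lt_of_le_of_lt hQ (lt_of_exp (by simp only [hθ]; linarith))
      · calc X⁻¹ * Q * R ^ 4 ≤ X⁻¹ * X ^ θ * X ^ ((1 / 7 : ℝ) * 4) := by
              refine mul_le_mul (mul_le_mul_of_nonneg_left hQ (by positivity)) hR4 (by positivity) ?_
              positivity
          _ = X ^ ((-1 : ℝ) + θ + (1 / 7 : ℝ) * 4) := by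
              rw [Real.rpow_add hX0, Real.rpow_add hX0, Real.rpow_neg hX0.le, Real.rpow_one]
          _ < X ^ (τ - ε₁) := lt_of_exp (by simp only [hθ]; linarith)
      · calc Q ^ (1 / 2 : ℝ) * R ≤ X ^ (θ * (1 / 2 : ℝ)) * X ^ (1 / 7 : ℝ) :=
              mul_le_mul hQhalf hR hRpos.le (Real.rpow_nonneg hX0.le _)
          _ = X ^ (θ * (1 / 2 : ℝ) + 1 / 7) := rpow_mul_rpow hX0 _ _
          _ < X ^ (τ - ε₁) := lt_of_exp (by simp only [hθ]; linarith)
      · calc X ^ (-2 : ℝ) * Q ^ 3 * R ^ 4 ≤ X ^ (-2 : ℝ) * X ^ (θ * 3) * X ^ ((1 / 7 : ℝ) * 4) := by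
              refine mul_le_mul (mul_le_mul_of_nonneg_left hQ3 (Real.rpow_nonneg hX0.le _)) hR4
                (by positivity) ?_
              exact mul_nonneg (Real.rpow_nonneg hX0.le _) (Real.rpow_nonneg hX0.le _)
          _ = X ^ ((-2 : ℝ) + θ * 3 + (1 / 7 : ℝ) * 4) := by
              rw [Real.rpow_add hX0, Real.rpow_add hX0]
          _ < X ^ (τ - ε₁) := lt_of_exp (by simp only [hθ]; linarith)
    calc X ^ ε₁ * thm5Threshold X Q R < X ^ ε₁ * X ^ (τ - ε₁) :=
          mul_lt_mul_of_pos_left hthr (Real.rpow_pos_of_pos hX0 _)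
      _ = M := by rw [rpow_mul_rpow hX0, hM]; congr 1; ring

end BFI

end Literature.NumberTheory.Sieve
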